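import Literature.NumberTheory.Automorphic.QuadraticLocalBaseChange   -- ★ `PlacesOver`, `LocalRing E v = ∏_{w∣v} E_w`, `toPlace`, `toLocalRing`, `existsUnique_eq_add_mul` (`E ⊗ F_v = F_v ⊕ F_v δ`)
import Mathlib.FieldTheory.KummerPolynomial
import HarnessLib

/-!
# A local quadratic field is a completion: the global model `E = F(√m) = AdjoinRoot (X² − m)`, non-splitting of a local non-square, and `E_w = F_v ⊕ F_v·√m` at the unique place
# — organ «LQC — K₁ AS A COMPLETION», bricks (QM) (QP) (Q2)  (Cassels–Fröhlich, Ch. II §10; Neukirch, *ANT*, Ch. II (8.2)–(8.3))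

Topic `NumberTheory/NumberFields`; namespace `Literature.NumberTheory.NumberFields`.  THEOREMS ONLY (no definition, no instance, no notation, no named fact, no `sorry`; the
Prop-classes `NumberField`, `Algebra.IsQuadraticExtension` are delivered as THEOREMS, `haveI`-able by consumers).  Cell `pub/hodgecm-mathlib` (D-0151), crux H413 =
`stmt-HodgeConjecture-24833`; road «S3-tree» (LEAD F0P3a-plan (g11) T10-38), brick T3′ P-2 (W2 census F0P3a-p04 (g16) addendum 1 §B: rows (R0²)(R2²) gated on «K₁ AS A COMPLETION»),
infrastructure organ **«LQC»** (architect A-p16 (g29) A-80 (2) → F0P3-p02 (g14)); sibling ★ `LocalSquareClassGlobalRepresentative` = brick (Q3) (every tame local square class has a global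
representative).  HONEST LABEL: HC_CM is proved only modulo the printed citations (2 remaining named inputs hLiu418 24832, h413 24833) until rung 0 closes; elementary algebra ∕ number
theory, asserts nothing printed.

THE MATHEMATICS.  (QM) For a non-square `m` of a number field `E`, `E(√m) := AdjoinRoot (X² − C m)` is a quadratic number field over `E` with `(√m)² = m` and a non-trivial
`E`-automorphism `c`, `c √m = −√m`.  (QP) If `m = δ² ∈ F` is NOT a square in the completion `F_v`, then `v` has exactly one place `w` in `E = F(δ)`: in `E ⊗_F F_v = ∏_{w∣v} E_w = F_v ⊕ F_v δ`
a second place would produce a non-trivial idempotent `ιa + ιb δ`, and `(ιa + ιb δ)² = ιa + ιb δ` forces `b = 0, a ∈ {0,1}` or `2a = 1, m(2b)² = 1`.  (Q2) At that unique `w`, the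
one-factor product gives `E_w = ι_w F_v ⊕ ι_w F_v·δ` with UNIQUE coordinates, and `δ² = ι_w m`.  With ★ (Q3) (`d ∈ F_v^×`, `|2|_v = 1` ⇒ `d ≡ m` mod squares for some `m ∈ F`) every
TAME local quadratic extension `F_v(√d)` is such an `E_w` — the «K₁ = E_w(√disc χ_g)» of T3′ type (2) acquires `adicCompletion` infrastructure (consumers: (R0²) `𝓀_{K₁}`, (R2²) `𝒪_{K₁}`,
`𝔪_{K₁}`, norm parity via ★ inert∕ramified files at the place `w` of `E`).  (Q4) — the `e·f = 2` dichotomy by the parity of `ord_v m` — is NOT in this file.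

* (QM) `irreducible_X_sq_sub_C_of_not_isSquare`, `not_isSquare_of_not_isSquare_algebraMap`, `root_X_sq_sub_C_sq`, `ne_zero_of_irreducible_X_sq_sub_C`, `root_X_sq_sub_C_ne_zero`,
  `finrank_adjoinRoot_X_sq_sub_C`, **`isQuadraticExtension_adjoinRoot`**, **`numberField_adjoinRoot`**, **`exists_algEquiv_root_eq_neg`**.
* (QP) **`subsingleton_placesOver_of_not_isSquare`**; (Q2) `algebraMap_adicCompletion_sq_eq_toPlace`, **`existsUnique_eq_toPlace_add_toPlace_mul`**.

## References
* [CasselsFrohlich1967] J. W. S. Cassels, A. Fröhlich (eds.), *Algebraic Number Theory* (1967): Ch. II §10 (`L ⊗_K K_v ≅ ∏_{w∣v} L_w`, completions of global fields).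
* [Neukirch1999] J. Neukirch, *Algebraic Number Theory*, Grundlehren 322 (1999): Ch. I §2, Ch. II (3.4), (8.2)–(8.3) (extensions of valuations, `∑ e_w f_w = n`).
* [Lang2002] S. Lang, *Algebra*, rev. 3rd ed., GTM 211 (2002): Ch. V §1 (simple extensions `k(α) = k[X]⁄(f)`), Ch. VI §1, §9 Thm. 9.1 (`X^n − a`).
-/

set_option autoImplicit false

noncomputable section

open NumberField IsDedekindDomain Polynomial
open Literature.NumberTheory.Automorphic Literature.NumberTheory.Automorphic.UnitaryGroup

namespace Literature.NumberTheory.NumberFields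

/-! ## (QM) the global quadratic field `E(√m) = AdjoinRoot (X² − m)` -/

section Global

variable {E : Type} [Field E] (m : E)

/-- `X² − m` is irreducible over a field when `m` is not a square (Mathlib `X_pow_sub_C_irreducible_iff_of_prime`). [cite: Lang2002, Ch. VI §9 Thm. 9.1] -/
theorem irreducible_X_sq_sub_C_of_not_isSquare (hm : ¬ IsSquare m) : Irreducible (X ^ 2 - C m : E[X]) := by
  refine (X_pow_sub_C_irreducible_iff_of_prime Nat.prime_two).2 fun b hb => hm ⟨b, ?_⟩
  rw [← hb, sq]

/-- A global element that is a non-square in some completion `E_w` is a non-square in `E`. [cite: Neukirch1999, Ch. II (3.4)] -/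
theorem not_isSquare_of_not_isSquare_algebraMap [NumberField E] {w : HeightOneSpectrum (𝓞 E)}
    (hns : ¬ IsSquare (algebraMap E (w.adicCompletion E) m)) : ¬ IsSquare m := by
  rintro ⟨b, hb⟩
  exact hns ⟨algebraMap E _ b, by rw [hb, map_mul]⟩

variable [Fact (Irreducible (X ^ 2 - C m : E[X]))]

/-- In `E(√m) := AdjoinRoot (X² − m)`: `(√m)² = m`. [cite: Lang2002, Ch. V §1] -/
theorem root_X_sq_sub_C_sq : (AdjoinRoot.root (X ^ 2 - C m : E[X])) ^ 2 = algebraMap E (AdjoinRoot (X ^ 2 - C m : E[X])) m := by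
  have h := AdjoinRoot.eval₂_root (X ^ 2 - C m : E[X])
  rw [eval₂_sub, eval₂_X_pow, eval₂_C, sub_eq_zero] at h
  rw [h]; rfl

/-- `X² − m` irreducible forces `m ≠ 0` (`X² = X·X`). [cite: Lang2002, Ch. V §1] -/
theorem ne_zero_of_irreducible_X_sq_sub_C : m ≠ 0 := by
  intro hm
  have hirr : Irreducible (X ^ 2 - C m : E[X]) := Fact.out
  rw [hm, map_zero, sub_zero, pow_two] at hirr
  exact (hirr.isUnit_or_isUnit rfl).elim Polynomial.not_isUnit_X Polynomial.not_isUnit_X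

/-- `√m ≠ 0` in `E(√m)`. [cite: Lang2002, Ch. V §1] -/
theorem root_X_sq_sub_C_ne_zero : AdjoinRoot.root (X ^ 2 - C m : E[X]) ≠ 0 := by
  intro h0
  have hm0 : algebraMap E (AdjoinRoot (X ^ 2 - C m : E[X])) m = 0 := by
    rw [← root_X_sq_sub_C_sq, h0, zero_pow two_ne_zero]
  exact ne_zero_of_irreducible_X_sq_sub_C m ((map_eq_zero_iff _ (algebraMap E (AdjoinRoot (X ^ 2 - C m : E[X]))).injective).1 hm0)

/-- `[E(√m) : E] = 2` (Mathlib `AdjoinRoot.powerBasis`). [cite: Lang2002, Ch. V §1 Prop. 1.4] -/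
theorem finrank_adjoinRoot_X_sq_sub_C : Module.finrank E (AdjoinRoot (X ^ 2 - C m : E[X])) = 2 := by
  have hf : (X ^ 2 - C m : E[X]) ≠ 0 := (Fact.out : Irreducible (X ^ 2 - C m : E[X])).ne_zero
  rw [(AdjoinRoot.powerBasis hf).finrank, AdjoinRoot.powerBasis_dim, natDegree_X_pow_sub_C]

/-- `E(√m)∕E` is a quadratic extension in Mathlib's sense (`Algebra.IsQuadraticExtension`; a Prop-class, so this THEOREM is `haveI`-able by consumers — no instance is declared here).
[cite: Lang2002, Ch. V §1 Prop. 1.4] -/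
theorem isQuadraticExtension_adjoinRoot : Algebra.IsQuadraticExtension E (AdjoinRoot (X ^ 2 - C m : E[X])) :=
  { finrank_eq_two' := finrank_adjoinRoot_X_sq_sub_C m }

/-- `E(√m)` is a number field when `E` is (Mathlib `NumberField.of_module_finite`; Prop-class, `haveI`-able). [cite: Neukirch1999, Ch. I §2] -/
theorem numberField_adjoinRoot [NumberField E] : NumberField (AdjoinRoot (X ^ 2 - C m : E[X])) := by
  have hf : (X ^ 2 - C m : E[X]) ≠ 0 := (Fact.out : Irreducible (X ^ 2 - C m : E[X])).ne_zero
  haveI : Module.Finite E (AdjoinRoot (X ^ 2 - C m : E[X])) := (AdjoinRoot.powerBasis hf).finite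
  exact NumberField.of_module_finite E (AdjoinRoot (X ^ 2 - C m : E[X]))

/-- **The non-trivial automorphism of `E(√m)∕E`**: there is `c : E(√m) ≃ₐ[E] E(√m)` with `c(√m) = −√m`, `c ≠ 1` (`AdjoinRoot.liftAlgHom` at the other root; `c ≠ 1` as `2√m ≠ 0`
in characteristic zero) — the `c` of the tree's `galAdicCompletionMap c` ∕ `PlacesOver` Galois bookkeeping. [cite: Lang2002, Ch. VI §1] -/
theorem exists_algEquiv_root_eq_neg [CharZero E] :
    ∃ c : AdjoinRoot (X ^ 2 - C m : E[X]) ≃ₐ[E] AdjoinRoot (X ^ 2 - C m : E[X]),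
      c (AdjoinRoot.root (X ^ 2 - C m : E[X])) = -AdjoinRoot.root (X ^ 2 - C m : E[X]) ∧ c ≠ 1 := by
  have hroot : (X ^ 2 - C m : E[X]).eval₂ (Algebra.ofId E (AdjoinRoot (X ^ 2 - C m : E[X]))) (-AdjoinRoot.root (X ^ 2 - C m : E[X])) = 0 := by
    rw [eval₂_sub, eval₂_X_pow, eval₂_C, neg_sq, root_X_sq_sub_C_sq]
    exact sub_self _
  set φ : AdjoinRoot (X ^ 2 - C m : E[X]) →ₐ[E] AdjoinRoot (X ^ 2 - C m : E[X]) :=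
    AdjoinRoot.liftAlgHom (X ^ 2 - C m : E[X]) (Algebra.ofId E _) (-AdjoinRoot.root (X ^ 2 - C m : E[X])) hroot with hφ
  have hφr : φ (AdjoinRoot.root (X ^ 2 - C m : E[X])) = -AdjoinRoot.root (X ^ 2 - C m : E[X]) := AdjoinRoot.liftAlgHom_root _ _ _ _
  have hφφ : φ.comp φ = AlgHom.id E _ := by
    apply AdjoinRoot.algHom_ext
    rw [AlgHom.comp_apply, hφr, map_neg, hφr, neg_neg, AlgHom.id_apply]
  refine ⟨AlgEquiv.ofAlgHom φ φ hφφ hφφ, hφr, fun h1 => ?_⟩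
  have h := congrArg (fun c : AdjoinRoot (X ^ 2 - C m : E[X]) ≃ₐ[E] AdjoinRoot (X ^ 2 - C m : E[X]) => c (AdjoinRoot.root (X ^ 2 - C m : E[X]))) h1
  simp only [AlgEquiv.ofAlgHom_apply, hφr, AlgEquiv.one_apply] at h
  have h2 : (2 : AdjoinRoot (X ^ 2 - C m : E[X])) * AdjoinRoot.root (X ^ 2 - C m : E[X]) = 0 := by linear_combination -h
  rcases mul_eq_zero.1 h2 with h2' | h0
  · -- `2 ≠ 0` in the `E`-algebra `AdjoinRoot`, `E` of characteristic zero
    have : (algebraMap E (AdjoinRoot (X ^ 2 - C m : E[X]))) 2 = 0 := by rw [map_ofNat]; exact h2'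
    exact two_ne_zero ((map_eq_zero_iff _ (algebraMap E (AdjoinRoot (X ^ 2 - C m : E[X]))).injective).1 this)
  · exact root_X_sq_sub_C_ne_zero m h0

end Global

/-! ## (QP) a local non-square does not split; (Q2) the completion at the unique place -/

section Local

variable {F : Type} (E : Type) [Field F] [NumberField F] [Field E] [NumberField E] [Algebra F E]

/-- **(QP) A LOCAL NON-SQUARE DOES NOT SPLIT: if `δ² = m ∈ F` with `m` NOT a square in `F_v`, the quadratic field `E = F(δ)` has exactly ONE place above `v`** (`Subsingleton (PlacesOver E v)`,
the letter's own non-split token).  Proof in the tree's model `E ⊗_F F_v = ∏_{w ∣ v} E_w = F_v ⊕ F_v·δ` (★ `QuadraticLocalBaseChange.existsUnique_eq_add_mul`): two places would give a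
non-trivial idempotent `e = ι a + ι b·δ`; `e² = e` forces `b = 0` (then `a² = a`, `e ∈ {0,1}`, absurd) or `2a = 1` and then `m·(2b)² = 1`, i.e. `m` is a square in `F_v`.
[cite: Neukirch1999, Ch. II (8.2)–(8.3)] [cite: CasselsFrohlich1967, Ch. II §10] -/
theorem subsingleton_placesOver_of_not_isSquare [Algebra.IsQuadraticExtension F E] (v : HeightOneSpectrum (𝓞 F))
    (σ : E ≃ₐ[F] E) {δ : E} (hσδ : σ δ = -δ) (hδ : δ ≠ 0) {m : F} (hm : algebraMap F E m = δ ^ 2)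
    (hns : ¬ IsSquare (m : v.adicCompletion F)) : Subsingleton (PlacesOver E v) := by
  classical
  by_contra hnot
  rw [not_subsingleton_iff_nontrivial] at hnot
  obtain ⟨w₁, w₂, hne⟩ := hnot
  -- the idempotent `e = 1_{w₁}`
  set e : LocalRing E v := Pi.single w₁ 1 with he
  have he2 : e * e = e := by
    rw [he, ← Pi.single_mul, mul_one]
  have he0 : e ≠ 0 := by
    intro h; have := congrFun h w₁; simp [he] at this
  have he1 : e ≠ 1 := by
    intro h; have := congrFun h w₂; simp [he, hne.symm] at this
  -- write `e = ι a + ι b δ`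
  obtain ⟨⟨a, b⟩, hab, huniq⟩ := existsUnique_eq_add_mul E v σ hσδ hδ e
  simp only at hab
  set ι := toLocalRing E v with hι
  set D : LocalRing E v := algebraMap E (LocalRing E v) δ with hD
  have hD2 : D * D = ι (m : v.adicCompletion F) := by
    rw [hD, ← map_mul, ← sq, ← hm, hι, toLocalRing_coe]
  -- expand `e² = e`
  have hsq : e = ι (a * a + b * b * m) + ι (2 * a * b) * D := by
    calc e = e * e := he2.symm
      _ = (ι a + ι b * D) * (ι a + ι b * D) := by rw [← hab]
      _ = ι (a * a + b * b * m) + ι (2 * a * b) * D := by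
          have : (ι a + ι b * D) * (ι a + ι b * D) = ι a * ι a + ι b * ι b * (D * D) + (2 * (ι a * ι b)) * D := by ring
          rw [this, hD2]; simp only [map_add, map_mul, map_ofNat]; ring
  have hab' := huniq ⟨a * a + b * b * m, 2 * a * b⟩ hsq
  simp only [Prod.mk.injEq] at hab'
  obtain ⟨ha, hb⟩ := hab'
  -- `b = 2ab` and `a = a² + b² m`
  by_cases hb0 : b = 0
  · -- then `e = ι a` with `a² = a`: `e ∈ {0, 1}`
    rw [hb0, mul_zero, zero_mul, add_zero] at ha
    rw [hb0, map_zero, zero_mul, add_zero] at hab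
    have ha01 : a = 0 ∨ a = 1 := by
      have : a * (a - 1) = 0 := by linear_combination ha
      rcases mul_eq_zero.1 this with h | h
      · exact Or.inl h
      · exact Or.inr (sub_eq_zero.1 h)
    rcases ha01 with rfl | rfl
    · exact he0 (by rw [hab, map_zero])
    · exact he1 (by rw [hab, map_one])
  · -- `2a = 1`, then `m = (2b)⁻²`: a square
    have h2a : 2 * a = 1 := by
      have : b * (2 * a - 1) = 0 := by linear_combination hb
      rcases mul_eq_zero.1 this with h | h
      · exact absurd h hb0
      · linear_combination h
    have h20 : (2 : v.adicCompletion F) ≠ 0 := fun h => by rw [h, zero_mul] at h2a; exact zero_ne_one h2a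
    have h2b : (2 * b : v.adicCompletion F) ≠ 0 := mul_ne_zero h20 hb0
    have key : (m : v.adicCompletion F) * (2 * b) ^ 2 = 1 := by linear_combination (4 : v.adicCompletion F) * ha - (2 * a - 1) * h2a
    have hm' : (m : v.adicCompletion F) = ((2 * b)⁻¹) ^ 2 := by
      rw [inv_pow]; exact eq_inv_of_mul_eq_one_left key
    exact hns ⟨(2 * b)⁻¹, by rw [hm', sq]⟩


/-- At a place `w ∣ v`: `δ² = ι_w(m)` in `E_w` for `δ² = m ∈ F` (`ι_w = toPlace v w`). [cite: CasselsFrohlich1967, Ch. II §10] -/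
theorem algebraMap_adicCompletion_sq_eq_toPlace (v : HeightOneSpectrum (𝓞 F)) (w : PlacesOver E v) {δ : E} {m : F}
    (hm : algebraMap F E m = δ ^ 2) :
    ((δ : E) : w.1.adicCompletion E) ^ 2 = toPlace v w (m : v.adicCompletion F) := by
  rw [toPlace_coe, hm]
  exact (map_pow (algebraMap E (w.1.adicCompletion E)) δ 2).symm

/-- **(Q2) THE COMPLETION AT THE UNIQUE PLACE IS `F_v ⊕ F_v·δ`**: if `v` is non-split in the quadratic `E = F(δ)` (`Subsingleton (PlacesOver E v)`, e.g. by (QP)) and `w` is the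
place above `v`, every `x ∈ E_w` is UNIQUELY `ι_w a + ι_w b·δ` with `a, b ∈ F_v` — so `[E_w : F_v] = 2`, `E_w = F_v(δ) ≅ F_v[X]⁄(X² − m)`: the local quadratic field `F_v(√m)` IS the
completion `E_w` with all of the tree's `adicCompletion` infrastructure (`Valued`, `ValuativeRel`, `𝒪`, `𝓀`, `IsNonarchimedeanLocalField`, `galAdicCompletionMap`) — organ «LQC».
(★ `existsUnique_eq_add_mul` on the one-factor product `∏_{w ∣ v} E_w`.) [cite: CasselsFrohlich1967, Ch. II §10] [cite: Neukirch1999, Ch. II (8.3)] -/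
theorem existsUnique_eq_toPlace_add_toPlace_mul [Algebra.IsQuadraticExtension F E] (v : HeightOneSpectrum (𝓞 F))
    (σ : E ≃ₐ[F] E) {δ : E} (hσδ : σ δ = -δ) (hδ : δ ≠ 0) [Subsingleton (PlacesOver E v)] (w : PlacesOver E v)
    (x : w.1.adicCompletion E) :
    ∃! p : v.adicCompletion F × v.adicCompletion F,
      x = toPlace v w p.1 + toPlace v w p.2 * ((δ : E) : w.1.adicCompletion E) := by
  classical
  -- transport `x` to the one-factor product `∏_{w' ∣ v} E_{w'}`
  set X : LocalRing E v := Pi.single w x with hX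
  have hXw : X w = x := by rw [hX, Pi.single_eq_same]
  have hev : ∀ (p : v.adicCompletion F × v.adicCompletion F),
      (toLocalRing E v p.1 + toLocalRing E v p.2 * algebraMap E (LocalRing E v) δ) w =
        toPlace v w p.1 + toPlace v w p.2 * ((δ : E) : w.1.adicCompletion E) := fun p => rfl
  obtain ⟨p, hp, huniq⟩ := existsUnique_eq_add_mul E v σ hσδ hδ X
  refine ⟨p, ?_, fun q hq => huniq q ?_⟩
  · have := congrFun hp w
    rwa [hXw, hev] at this
  · funext w'
    obtain rfl : w' = w := Subsingleton.elim _ _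
    rw [hXw, hev]
    exact hq


end Local

end Literature.NumberTheory.NumberFields

end
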